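import Mathlib
import HarnessLib.Audit
import Summits.PneNP.PneNP.Theorems.PstarGateNodesX

/-!
# An UNREAD BRIDGE contradicts (T3) + (M0): a tree edge on no fundamental cycle and in no join cannot be minimal (E2; prover-1 g19)

FRONTIER range-avoidance ladder, rung F-N3 (`stmt-PneNP-19007`), cell `pnp-ideate`; restricted-model proof complexity — nothing here bears on `P`
versus `NP`.

Bridge data `B` on an XOR-closed core; a non-chord output `b` lying on NO fundamental set `D e` (a bridge of the XOR multigraph of `J₀`) and in
NEITHER join `T₁, T₂` (unread by both constraints).  Dropping `b` from the core gives bridge data `{ B with J₀ := B.J₀.erase b }` that are still well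
formed (`dropEdge_wf`: the endpoints of `b` remain XOR vertices of the rest of the forest, because the core is
XOR-closed and a chord's endpoints lie on its own fundamental path; the chords stay chords) with the SAME chord system (`sys_dropEdge_F`).  Hence a solution of `(J₀ − b) ∧ Γ₁ ∧ Γ₂` — (M0) at
`b` — is a solution of the whole dropped system and refutes infeasibility of the model (`not_infeasible_of_solution`):

* `false_of_bridge_minimal` — **(T3) + (M0) at an unread bridge is contradictory.**  So in a minimal configuration every tree edge lies on a
  fundamental cycle or is read through a join.
-/

set_option linter.dupNamespace false -- `Summit.PneNP.PneNP.…`: summit = sub-problem name (D-0017 single-conjunct layout)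

open Finset Literature.Computability.Complexity
open Summit.PneNP.PneNP.Theorems.PstarTyped (Typed)
open Summit.PneNP.PneNP.Theorems.PstarSALevel (varSet bdry)
open Summit.PneNP.PneNP.Theorems.PstarCentreFree (vars_mem_varSet)
open Summit.PneNP.PneNP.Theorems.PstarXCore (xpair xverts mem_xpair)
open Summit.PneNP.PneNP.Theorems.PstarCoreBound (XorClosed)
open Summit.PneNP.PneNP.Theorems.PstarChordRepair (IsChord)
open Summit.PneNP.PneNP.Theorems.PstarReadSumset (V2)
open Summit.PneNP.PneNP.Theorems.PstarChordSystem (ChordSystem)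
open Summit.PneNP.PneNP.Theorems.PstarChordBridgeTools (privs xpdeg)
open Summit.PneNP.PneNP.Theorems.PstarChordBridge (BridgeData sys sys_F Solution not_infeasible_of_solution)
open Summit.PneNP.PneNP.Theorems.PstarChordBridgeFundamental (odd_of_end)
open Summit.PneNP.PneNP.Theorems.PstarChordBridgeCotree (mem_xverts_iff_xpdeg_pos)
open Summit.PneNP.PneNP.Theorems.PstarNorCoreTools (not_mem_bdry_of_two)

namespace Summit.PneNP.PneNP.Theorems.PstarBridgeUnread

variable {n m : ℕ}

/-- A boundary variable of `J` held by a member of `J' ⊆ J` is a boundary variable of `J'`. -/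
theorem mem_bdry_of_subset (I : LocalMap 4 n m) {J J' : Finset (Fin m)} (hJJ : J' ⊆ J) {v : Fin n} (hv : v ∈ bdry I J) {e : Fin m}
    (he : e ∈ J') (hve : v ∈ varSet I e) : v ∈ bdry I J' := by
  classical
  unfold PstarSALevel.bdry at hv ⊢
  rw [mem_filter] at hv ⊢
  refine ⟨mem_univ _, ?_⟩
  obtain ⟨-, h1⟩ := hv
  obtain ⟨e₀, he₀⟩ := card_eq_one.1 h1
  have hee₀ : e = e₀ := by
    have : e ∈ J.filter (fun j => v ∈ varSet I j) := mem_filter.2 ⟨hJJ he, hve⟩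
    rw [he₀] at this; exact mem_singleton.1 this
  rw [card_eq_one]
  refine ⟨e, eq_singleton_iff_unique_mem.2 ⟨mem_filter.2 ⟨he, hve⟩, fun j hj => ?_⟩⟩
  have : j ∈ J.filter (fun j => v ∈ varSet I j) := mem_filter.2 ⟨hJJ (mem_filter.1 hj).1, (mem_filter.1 hj).2⟩
  rw [he₀] at this
  rw [mem_singleton.1 this, ← hee₀]

/-- **The endpoints of an unread bridge are XOR vertices of the rest of the forest**, so dropping it keeps the XOR vertices of the non-chords. -/
theorem xverts_dropEdge (I : LocalMap 4 n m) (hI : I.IsPure xorAndPred) (hT : Typed I) {B : BridgeData n m} (hW : B.WF I) (hX : XorClosed I B.J₀)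
    {b : Fin m} (hb : b ∈ B.J₀ \ B.N) (hbD : ∀ c ∈ B.N, b ∉ B.D c) :
    xverts I (B.J₀.erase b \ B.N) = xverts I (B.J₀ \ B.N) := by
  classical
  obtain ⟨hbJ, hbN⟩ := mem_sdiff.1 hb
  have hsub : B.J₀.erase b \ B.N ⊆ B.J₀ \ B.N := sdiff_subset_sdiff (erase_subset _ _) (subset_refl _)
  refine Subset.antisymm (by unfold PstarXCore.xverts; exact biUnion_subset_biUnion_of_subset_left _ hsub) fun w hw => ?_
  unfold PstarXCore.xverts at hw ⊢
  obtain ⟨j, hj, hwj⟩ := mem_biUnion.1 hw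
  by_cases hjb : j = b
  swap
  · exact mem_biUnion.2 ⟨j, mem_sdiff.2 ⟨mem_erase.2 ⟨hjb, (mem_sdiff.1 hj).1⟩, (mem_sdiff.1 hj).2⟩, hwj⟩
  subst hjb
  -- `w` is an endpoint of the bridge: by closedness some other output of the core holds `w`
  obtain ⟨s, hs2, hws⟩ : ∃ s : Fin 4, s.val < 2 ∧ w = I.vars j s := by
    rcases (mem_xpair I).1 hwj with h | h
    · exact ⟨0, by decide, h⟩
    · exact ⟨1, by decide, h⟩
  have hnb := hX j hbJ s hs2
  rw [← hws] at hnb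
  -- some other output `j'` of `J₀` holds `w`
  obtain ⟨j', hj'J, hj'ne, hwj'⟩ : ∃ j' ∈ B.J₀, j' ≠ j ∧ w ∈ varSet I j' := by
    by_contra hno
    push Not at hno
    apply hnb
    unfold PstarSALevel.bdry
    rw [mem_filter, card_eq_one]
    refine ⟨mem_univ _, j, eq_singleton_iff_unique_mem.2 ⟨mem_filter.2 ⟨hbJ, hws ▸ vars_mem_varSet I j s⟩, fun i hi => ?_⟩⟩
    by_contra hij
    exact hno i (mem_filter.1 hi).1 hij (mem_filter.1 hi).2
  -- `w` is an XOR-type variable, so it sits in an XOR slot of `j'`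
  have hwx : w ∈ xpair I j' := by
    unfold PstarSALevel.varSet at hwj'
    obtain ⟨s', -, hs'⟩ := mem_image.1 hwj'
    by_cases hs'2 : s'.val < 2
    · rcases (show s' = 0 ∨ s' = 1 by rcases s' with ⟨s', hs4⟩; simp only [Fin.ext_iff]; simp only at hs'2; omega) with rfl | rfl
      · exact (mem_xpair I).2 (Or.inl hs'.symm)
      · exact (mem_xpair I).2 (Or.inr hs'.symm)
    · exfalso
      exact hT j j' s s' hs2 (by omega) (hws ▸ hs'.symm)
  by_cases hj'N : j' ∈ B.N
  · -- `j'` is a chord: its endpoint `w` lies on its fundamental path, which avoids the bridge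
    have hj'D : j' ∉ B.D j' := fun h => (mem_sdiff.1 (hW.hD j' hj'N h)).2 hj'N
    obtain ⟨s', hs'2, hws'⟩ : ∃ s' : Fin 4, s'.val < 2 ∧ w = I.vars j' s' := by
      rcases (mem_xpair I).1 hwx with h | h
      · exact ⟨0, by decide, h⟩
      · exact ⟨1, by decide, h⟩
    have hodd := odd_of_end I hI hj'D (hW.hDeven j' hj'N) hs'2
    rw [← hws'] at hodd
    obtain ⟨d, hd, hwd⟩ : ∃ d ∈ B.D j', w ∈ xpair I d := by
      have hpos := hodd.pos
      have h := (mem_xverts_iff_xpdeg_pos I (B.D j') w).2 hpos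
      unfold PstarXCore.xverts at h
      exact mem_biUnion.1 h
    have hdb : d ≠ j := fun h => hbD j' hj'N (h ▸ hd)
    have hdF := hW.hD j' hj'N hd
    exact mem_biUnion.2 ⟨d, mem_sdiff.2 ⟨mem_erase.2 ⟨hdb, (mem_sdiff.1 hdF).1⟩, (mem_sdiff.1 hdF).2⟩, hwd⟩
  · -- `j'` is another tree edge
    exact mem_biUnion.2 ⟨j', mem_sdiff.2 ⟨mem_erase.2 ⟨hj'ne, hj'J⟩, hj'N⟩, hwx⟩

/-- **Dropping an unread bridge keeps the bridge data well formed.** -/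
theorem dropEdge_wf (I : LocalMap 4 n m) (hI : I.IsPure xorAndPred) (hT : Typed I) {B : BridgeData n m} (hW : B.WF I) (hX : XorClosed I B.J₀)
    {b : Fin m} (hb : b ∈ B.J₀ \ B.N) (hbD : ∀ c ∈ B.N, b ∉ B.D c) (hbT₁ : b ∉ B.T₁) (hbT₂ : b ∉ B.T₂) :
    ({ B with J₀ := B.J₀.erase b } : BridgeData n m).WF I := by
  classical
  obtain ⟨hbJ, hbN⟩ := mem_sdiff.1 hb
  have hxv := xverts_dropEdge I hI hT hW hX hb hbD
  have hsubJ : B.J₀.erase b ⊆ B.J₀ := erase_subset _ _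
  refine ⟨?_, ?_, ?_, ?_, ?_, ?_, ?_, ?_, hW.hcross₁, hW.hcross₂⟩
  · intro e he; exact mem_erase.2 ⟨fun h => hbN (h ▸ he), hW.hN he⟩
  · intro e he
    have heJ' : e ∈ B.J₀.erase b := mem_erase.2 ⟨fun h => hbN (h ▸ he), hW.hN he⟩
    obtain ⟨h2, h3⟩ := hW.hchord e he
    exact ⟨mem_bdry_of_subset I hsubJ h2 heJ' (vars_mem_varSet I e 2), mem_bdry_of_subset I hsubJ h3 heJ' (vars_mem_varSet I e 3)⟩
  · intro e he j hj
    have h := hW.hD e he hj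
    exact mem_sdiff.2 ⟨mem_erase.2 ⟨fun hjb => hbD e he (hjb ▸ hj), (mem_sdiff.1 h).1⟩, (mem_sdiff.1 h).2⟩
  · exact hW.hDeven
  · intro j hj
    have h := hW.hT₁ hj
    exact mem_sdiff.2 ⟨mem_erase.2 ⟨fun hjb => hbT₁ (hjb ▸ hj), (mem_sdiff.1 h).1⟩, (mem_sdiff.1 h).2⟩
  · intro j hj
    have h := hW.hT₂ hj
    exact mem_sdiff.2 ⟨mem_erase.2 ⟨fun hjb => hbT₂ (hjb ▸ hj), (mem_sdiff.1 h).1⟩, (mem_sdiff.1 h).2⟩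
  · intro w
    show Odd (xpdeg I B.T₁ w) ↔ w ∈ B.C₁ ∧ w ∈ xverts I (B.J₀.erase b \ B.N)
    rw [hxv]; exact hW.hjoin₁ w
  · intro w
    show Odd (xpdeg I B.T₂ w) ↔ w ∈ B.C₂ ∧ w ∈ xverts I (B.J₀.erase b \ B.N)
    rw [hxv]; exact hW.hjoin₂ w

/-- The dropped data have the same state-free part, hence the same chord system. -/
theorem sys_dropEdge_F (I : LocalMap 4 n m) (hI : I.IsPure xorAndPred) (hT : Typed I) {B : BridgeData n m} (hW : B.WF I) (hX : XorClosed I B.J₀)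
    {b : Fin m} (hb : b ∈ B.J₀ \ B.N) (hbD : ∀ c ∈ B.N, b ∉ B.D c) (x : Fin n → ZMod 2) :
    (sys I ({ B with J₀ := B.J₀.erase b } : BridgeData n m)).F x = (sys I B).F x := by
  show (PstarChordBridgeTools.free I B.y (B.J₀.erase b \ B.N) B.N B.T₁ B.C₁ B.G₁ x,
      PstarChordBridgeTools.free I B.y (B.J₀.erase b \ B.N) B.N B.T₂ B.C₂ B.G₂ x) =
    (PstarChordBridgeTools.free I B.y (B.J₀ \ B.N) B.N B.T₁ B.C₁ B.G₁ x, PstarChordBridgeTools.free I B.y (B.J₀ \ B.N) B.N B.T₂ B.C₂ B.G₂ x)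
  unfold PstarChordBridgeTools.free
  rw [xverts_dropEdge I hI hT hW hX hb hbD]

/-- **(T3) + (M0) at an unread bridge is contradictory.**  If the model of `B` is infeasible, no solution of `(J₀ − b) ∧ Γ₁ ∧ Γ₂` exists for a
non-chord `b` on no fundamental set and in neither join. -/
theorem false_of_bridge_minimal (I : LocalMap 4 n m) (hI : I.IsPure xorAndPred) (hT : Typed I) {B : BridgeData n m} (hW : B.WF I)
    (hX : XorClosed I B.J₀) (hinf : (sys I B).Infeasible B.N) {b : Fin m} (hb : b ∈ B.J₀ \ B.N) (hbD : ∀ c ∈ B.N, b ∉ B.D c)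
    (hbT₁ : b ∉ B.T₁) (hbT₂ : b ∉ B.T₂) {z : Fin n → Bool} (hz : Solution I B (B.J₀.erase b) z) : False := by
  have hW' := dropEdge_wf I hI hT hW hX hb hbD hbT₁ hbT₂
  have hz' : Solution I ({ B with J₀ := B.J₀.erase b } : BridgeData n m) (B.J₀.erase b) z := hz
  refine not_infeasible_of_solution I hI hT hW' hz' ?_
  intro x s hadm hval
  refine hinf x s hadm ?_
  have hF := sys_dropEdge_F I hI hT hW hX hb hbD x
  have hv : (sys I ({ B with J₀ := B.J₀.erase b } : BridgeData n m)).val B.N x s = (sys I B).val B.N x s := by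
    unfold ChordSystem.val ChordSystem.contrib
    rw [hF]
    rfl
  rw [← hv]
  exact hval

end Summit.PneNP.PneNP.Theorems.PstarBridgeUnread
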